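import Summits.NavierStokesRegularity.FluidComputer.EulerRateInequality
import HarnessLib

/-!
# Fluid computer — support: the `Ḃ^{5/2}_{2,1}` row `P(τ) = ∑_l 2^{5l/2} ‖Δ̇_l u(τ)‖₂` and the fine-pair sums
# `Q_l(τ)` are finite and CONTINUOUS IN TIME on interior windows

HONEST FRAMING (cell `pub-fluidc`, verbatim): *low prior, high value-of-information experiment on Tao's
machine paradigm; NOT a claim that NS blows up.* Support file. Along a maximal smooth solution `(u, p)` of the
unforced Navier–Stokes system on `ℝ³ × [0, T)` (`ν > 0`), Leray–Hopf from `u 0`, on a window `[s, t] ⊂ (0, T)`: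

* `weight52_le_geom`, `summable_geom_natAbs` — from the decay data of `HighRows.exists_decay_le` (`(2^l)³ a_l ≤ D`, `‖u‖₂ ≤ E₀`):
  `2^{5l/2} a_l(τ) ≤ (D + C₂E₀) · 2^{−|l|/2}` for every `l ∈ ℤ`, uniformly in `τ` — a summable envelope over `ℤ`;
* `continuousOn_weight52_blockL2` — each term `τ ↦ 2^{5l/2} a_l(τ)` is continuous (`a_l = √(a_l²)`,
  `BlockEnergyContinuity.continuousOn_blockL2_sq`);
* `exists_lipRow_envelope`, `continuousOn_lipRow` — `P(τ) < ∞`, `P(τ).toReal = ∑_l (2^{5l/2}a_l(τ)).toReal`, and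
  `τ ↦ P(τ)` is continuous on `[s, t]` (Weierstrass M-test, Mathlib `continuousOn_tsum`, over `ℤ` via `Summable.of_nat_of_neg`);
* `continuousOn_paraQ2` — for every level `l`, `τ ↦ Q_l(τ) = ∑_{l' ≥ l−4, |m| ≤ 2} a_{l'} 2^{l'+m} a_{l'+m}` is finite
  and continuous on `[s, t]` (envelope `8(D + C₂E₀)² 2^{16−4l} 2^{−4n}`).

These feed the square-root comparison (`LipRowTools.sqrt_le_sqrt_add_integral`), which needs CONTINUOUS majorants of
the block transfers. 0 sorry; no definitions; no named facts.

## References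

* D. S. McCormick et al., SIAM J. Math. Anal. 48 (2016) 2119–2132. [MccormickEtAl2016]
* H. Bahouri, J.-Y. Chemin, R. Danchin, Grundlehren 343 (2011), Lemma 2.1. [BahouriCheminDanchin2011]
-/

noncomputable section

open MeasureTheory Set Function Filter Topology
open scoped ENNReal NNReal
open Literature.Analysis.FluidPDE Literature.Analysis.FunctionSpaces
open Summit.NavierStokesRegularity.FluidComputer.BlockEnergyTransport
open Summit.NavierStokesRegularity.FluidComputer.BlockEnergyContinuity
open Summit.NavierStokesRegularity.FluidComputer.RiccatiSummationGen (two_rpow_add)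

namespace Summit.NavierStokesRegularity.FluidComputer.LipRowContinuity

/-! ## A summable envelope for the terms `2^{5l/2} a_l` -/

/-- **Envelope from decay data.** If `(2^l)³ a_l ≤ D` and `a_l ≤ B` for all `l`, then
`2^{5l/2} a_l ≤ (D + B) · 2^{−|l|/2}` for every `l ∈ ℤ` (`l ≥ 0`: `2^{5l/2}(2^l)^{−3} = 2^{−l/2}`; `l < 0`:
`2^{5l/2} ≤ 2^{l/2}`). [folklore] -/
theorem weight52_le_geom {a : ℤ → ℝ≥0∞} {D B : ℝ≥0∞} (hD : ∀ l : ℤ, ((2 : ℝ≥0∞) ^ l) ^ 3 * a l ≤ D)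
    (hB : ∀ l : ℤ, a l ≤ B) (l : ℤ) :
    (2 : ℝ≥0∞) ^ ((5 / 2 : ℝ) * (l : ℝ)) * a l ≤ (D + B) * (2 : ℝ≥0∞) ^ (-(1 / 2 : ℝ) * ((l.natAbs : ℕ) : ℝ)) := by
  rcases le_or_gt 0 l with hl | hl
  · -- `l ≥ 0`: use the decay
    have hla : ((l.natAbs : ℕ) : ℝ) = (l : ℝ) := by
      rw [← Int.cast_natCast, Int.natAbs_of_nonneg hl]
    rw [hla]
    have e : (2 : ℝ≥0∞) ^ ((5 / 2 : ℝ) * (l : ℝ)) = (2 : ℝ≥0∞) ^ (-(1 / 2 : ℝ) * (l : ℝ)) * ((2 : ℝ≥0∞) ^ l) ^ 3 := by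
      rw [show ((2 : ℝ≥0∞) ^ l) ^ 3 = (2 : ℝ≥0∞) ^ ((3 : ℝ) * (l : ℝ)) by
        rw [RiccatiSlice.two_rpow_mul_intCast, show (3 : ℝ) = ((3 : ℕ) : ℝ) by norm_num, ENNReal.rpow_natCast],
        ← two_rpow_add]
      congr 1; ring
    calc (2 : ℝ≥0∞) ^ ((5 / 2 : ℝ) * (l : ℝ)) * a l
        = (2 : ℝ≥0∞) ^ (-(1 / 2 : ℝ) * (l : ℝ)) * (((2 : ℝ≥0∞) ^ l) ^ 3 * a l) := by rw [e]; ring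
      _ ≤ (2 : ℝ≥0∞) ^ (-(1 / 2 : ℝ) * (l : ℝ)) * D := mul_le_mul' le_rfl (hD l)
      _ ≤ (D + B) * (2 : ℝ≥0∞) ^ (-(1 / 2 : ℝ) * (l : ℝ)) := by rw [mul_comm]; gcongr; exact le_self_add
  · -- `l < 0`: use the energy
    have hla : ((l.natAbs : ℕ) : ℝ) = -(l : ℝ) := by
      have : ((l.natAbs : ℕ) : ℤ) = -l := Int.ofNat_natAbs_of_nonpos hl.le
      rw [← Int.cast_natCast, this]; push_cast; ring
    rw [hla]
    have hl' : (l : ℝ) < 0 := by exact_mod_cast hl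
    have hw : (2 : ℝ≥0∞) ^ ((5 / 2 : ℝ) * (l : ℝ)) ≤ (2 : ℝ≥0∞) ^ (-(1 / 2 : ℝ) * -(l : ℝ)) :=
      ENNReal.rpow_le_rpow_of_exponent_le (by norm_num) (by nlinarith)
    calc (2 : ℝ≥0∞) ^ ((5 / 2 : ℝ) * (l : ℝ)) * a l ≤ (2 : ℝ≥0∞) ^ (-(1 / 2 : ℝ) * -(l : ℝ)) * B := mul_le_mul' hw (hB l)
      _ ≤ (D + B) * (2 : ℝ≥0∞) ^ (-(1 / 2 : ℝ) * -(l : ℝ)) := by rw [mul_comm]; gcongr; exact le_add_self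

/-- The real geometric envelope `l ↦ c · 2^{−|l|/2}` is summable over `ℤ`. [folklore] -/
theorem summable_geom_natAbs (c : ℝ) :
    Summable fun l : ℤ => c * (2 : ℝ) ^ (-(1 / 2 : ℝ) * ((l.natAbs : ℕ) : ℝ)) := by
  have hr : (2 : ℝ) ^ (-(1 / 2 : ℝ)) < 1 := Real.rpow_lt_one_of_one_lt_of_neg (by norm_num) (by norm_num)
  have hr0 : 0 ≤ (2 : ℝ) ^ (-(1 / 2 : ℝ)) := by positivity
  have hg : Summable fun n : ℕ => c * ((2 : ℝ) ^ (-(1 / 2 : ℝ))) ^ n :=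
    (summable_geometric_of_lt_one hr0 hr).mul_left c
  have hre : ∀ n : ℕ, c * (2 : ℝ) ^ (-(1 / 2 : ℝ) * (n : ℝ)) = c * ((2 : ℝ) ^ (-(1 / 2 : ℝ))) ^ n := fun n => by
    rw [← Real.rpow_natCast, ← Real.rpow_mul (by norm_num)]
  refine Summable.of_nat_of_neg ?_ ?_
  · simpa only [Int.natAbs_natCast, hre] using hg
  · simpa only [Int.natAbs_neg, Int.natAbs_natCast, hre] using hg

/-! ## Along a maximal solution: finiteness and continuity of the `Ḃ^{5/2}_{2,1}` row -/

/-- **Continuity in time of each term** `τ ↦ (2^{5l/2} ‖Δ̇_l u(τ)‖₂).toReal` on every `[s, t] ⊂ (0, T)`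
(`a_l = √(a_l²)`, `BlockEnergyContinuity.continuousOn_blockL2_sq`). [folklore] -/
theorem continuousOn_weight52_blockL2 {ν T : ℝ} (hν : 0 < ν) (hT : 0 < T)
    {u : ℝ → EuclideanSpace ℝ (Fin 3) → EuclideanSpace ℝ (Fin 3)} {p : ℝ → EuclideanSpace ℝ (Fin 3) → ℝ}
    (hmax : IsMaximalSmoothSolution ν 0 u p T) (hLH : IsLerayHopfOn T ν 0 (u 0) u)
    {s t : ℝ} (hs : 0 < s) (htT : t < T) (w : ℝ≥0∞) (l : ℤ) :
    ContinuousOn (fun τ => (w * blockL2 (u τ) l).toReal) (Icc s t) := by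
  have hsub : Icc s t ⊆ Ioo 0 T := fun τ hτ => ⟨hs.trans_le hτ.1, hτ.2.trans_lt htT⟩
  have haj : ∀ τ ∈ Icc s t, blockL2 (u τ) l ≠ ∞ := fun τ hτ =>
    (((isSmoothL2Field_slice_of_maximal hν hT hmax hLH (hsub hτ)).blockFn l).memLp_two).eLpNorm_ne_top
  -- `a_l(τ).toReal = √((a_l(τ)²).toReal)`
  have hsq : ContinuousOn (fun τ => (blockL2 (u τ) l ^ 2).toReal) (Icc s t) :=
    ENNReal.continuousOn_toReal.comp ((continuousOn_blockL2_sq hν hT hmax hLH l).mono hsub)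
      fun τ hτ => ENNReal.pow_ne_top (haj τ hτ)
  have heq : ∀ τ ∈ Icc s t, (w * blockL2 (u τ) l).toReal = w.toReal * Real.sqrt ((blockL2 (u τ) l ^ 2).toReal) := by
    intro τ hτ
    rw [ENNReal.toReal_mul, ENNReal.toReal_pow, Real.sqrt_sq ENNReal.toReal_nonneg]
  exact (continuousOn_const.mul (Real.continuous_sqrt.comp_continuousOn hsq)).congr heq

/-- **The `Ḃ^{5/2}_{2,1}` row is finite on interior windows and equals the real series of its terms.** For
`0 < s ≤ t < T` there is a real `B ≥ 0` such that for every `τ ∈ [s, t]` and every `l`: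
`(2^{5l/2} a_l(τ)).toReal ≤ B · 2^{−|l|/2}`, `P(τ) = ∑_l 2^{5l/2} a_l(τ) < ∞`, and `P(τ).toReal = ∑_l (2^{5l/2} a_l(τ)).toReal`.
[folklore] -/
theorem exists_lipRow_envelope {ν T : ℝ} (hν : 0 < ν) (hT : 0 < T)
    {u : ℝ → EuclideanSpace ℝ (Fin 3) → EuclideanSpace ℝ (Fin 3)} {p : ℝ → EuclideanSpace ℝ (Fin 3) → ℝ}
    (hmax : IsMaximalSmoothSolution ν 0 u p T) (hLH : IsLerayHopfOn T ν 0 (u 0) u)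
    {s t : ℝ} (hs : 0 < s) (hst : s ≤ t) (htT : t < T) :
    ∃ B : ℝ, 0 ≤ B ∧ ∀ τ ∈ Icc s t,
      (∀ l : ℤ, ((2 : ℝ≥0∞) ^ ((5 / 2 : ℝ) * (l : ℝ)) * blockL2 (u τ) l).toReal ≤
          B * (2 : ℝ) ^ (-(1 / 2 : ℝ) * ((l.natAbs : ℕ) : ℝ))) ∧
      (∑' l : ℤ, (2 : ℝ≥0∞) ^ ((5 / 2 : ℝ) * (l : ℝ)) * blockL2 (u τ) l) ≠ ∞ ∧
      (∑' l : ℤ, (2 : ℝ≥0∞) ^ ((5 / 2 : ℝ) * (l : ℝ)) * blockL2 (u τ) l).toReal =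
        ∑' l : ℤ, ((2 : ℝ≥0∞) ^ ((5 / 2 : ℝ) * (l : ℝ)) * blockL2 (u τ) l).toReal := by
  set K := lpBounds (Fin 3) with hK
  obtain ⟨D, E₀, hDE⟩ := HighRows.exists_decay_le 0 hν hT hmax hLH hs hst htT
  set Be : ℝ≥0∞ := (D : ℝ≥0∞) + K.C₂ * E₀ with hBe
  have hBetop : Be ≠ ∞ := ENNReal.add_ne_top.2 ⟨ENNReal.coe_ne_top, ENNReal.mul_ne_top ENNReal.coe_ne_top ENNReal.coe_ne_top⟩
  have hsub : Icc s t ⊆ Ioo 0 T := fun τ hτ => ⟨hs.trans_le hτ.1, hτ.2.trans_lt htT⟩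
  refine ⟨Be.toReal, ENNReal.toReal_nonneg, fun τ hτ => ?_⟩
  have hw : IsSmoothL2Field (u τ) := isSmoothL2Field_slice_of_maximal hν hT hmax hLH (hsub hτ)
  have hDl : ∀ l : ℤ, ((2 : ℝ≥0∞) ^ l) ^ 3 * blockL2 (u τ) l ≤ D := fun l => by
    have h := (hDE τ hτ).1 l
    simpa only [zero_add] using h
  have hBl : ∀ l : ℤ, blockL2 (u τ) l ≤ K.C₂ * E₀ := fun l =>
    (K.blockL2_le hw.memLp_two l).trans (mul_le_mul' le_rfl (hDE τ hτ).2)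
  have henv : ∀ l : ℤ, (2 : ℝ≥0∞) ^ ((5 / 2 : ℝ) * (l : ℝ)) * blockL2 (u τ) l ≤
      Be * (2 : ℝ≥0∞) ^ (-(1 / 2 : ℝ) * ((l.natAbs : ℕ) : ℝ)) := fun l => weight52_le_geom hDl hBl l
  have henvR : ∀ l : ℤ, ((2 : ℝ≥0∞) ^ ((5 / 2 : ℝ) * (l : ℝ)) * blockL2 (u τ) l).toReal ≤
      Be.toReal * (2 : ℝ) ^ (-(1 / 2 : ℝ) * ((l.natAbs : ℕ) : ℝ)) := by
    intro l
    have h := ENNReal.toReal_mono (ENNReal.mul_ne_top hBetop (RiccatiSlice.two_rpow_ne_top _)) (henv l)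
    rwa [ENNReal.toReal_mul (a := Be), ← ENNReal.toReal_rpow, ENNReal.toReal_ofNat] at h
  have hterm_top : ∀ l : ℤ, (2 : ℝ≥0∞) ^ ((5 / 2 : ℝ) * (l : ℝ)) * blockL2 (u τ) l ≠ ∞ := fun l =>
    ENNReal.mul_ne_top (RiccatiSlice.two_rpow_ne_top _) ((hw.blockFn l).memLp_two).eLpNorm_ne_top
  -- finiteness of the row: bounded by the summable envelope
  have hPtop : (∑' l : ℤ, (2 : ℝ≥0∞) ^ ((5 / 2 : ℝ) * (l : ℝ)) * blockL2 (u τ) l) ≠ ∞ := by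
    have h1 : ∑' l : ℤ, (2 : ℝ≥0∞) ^ ((5 / 2 : ℝ) * (l : ℝ)) * blockL2 (u τ) l ≤
        ∑' l : ℤ, Be * (2 : ℝ≥0∞) ^ (-(1 / 2 : ℝ) * ((l.natAbs : ℕ) : ℝ)) := ENNReal.tsum_le_tsum henv
    refine ne_top_of_le_ne_top ?_ h1
    have hre : ∀ l : ℤ, Be * (2 : ℝ≥0∞) ^ (-(1 / 2 : ℝ) * ((l.natAbs : ℕ) : ℝ)) =
        ENNReal.ofReal (Be.toReal * (2 : ℝ) ^ (-(1 / 2 : ℝ) * ((l.natAbs : ℕ) : ℝ))) := by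
      intro l
      rw [ENNReal.ofReal_mul ENNReal.toReal_nonneg, ENNReal.ofReal_toReal hBetop,
        ← ENNReal.ofReal_rpow_of_pos two_pos, ENNReal.ofReal_ofNat]
    rw [tsum_congr hre]
    exact (summable_geom_natAbs Be.toReal).tsum_ofReal_ne_top
  exact ⟨henvR, hPtop, ENNReal.tsum_toReal_eq hterm_top⟩

/-- **The `Ḃ^{5/2}_{2,1}` row is continuous in time on interior windows**: `τ ↦ (∑_l 2^{5l/2} ‖Δ̇_l u(τ)‖₂).toReal` is
continuous on every `[s, t] ⊂ (0, T)` along a maximal smooth Leray–Hopf solution (Weierstrass M-test with the envelope of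
`exists_lipRow_envelope`). [folklore] -/
theorem continuousOn_lipRow {ν T : ℝ} (hν : 0 < ν) (hT : 0 < T)
    {u : ℝ → EuclideanSpace ℝ (Fin 3) → EuclideanSpace ℝ (Fin 3)} {p : ℝ → EuclideanSpace ℝ (Fin 3) → ℝ}
    (hmax : IsMaximalSmoothSolution ν 0 u p T) (hLH : IsLerayHopfOn T ν 0 (u 0) u)
    {s t : ℝ} (hs : 0 < s) (hst : s ≤ t) (htT : t < T) :
    ContinuousOn (fun τ => (∑' l : ℤ, (2 : ℝ≥0∞) ^ ((5 / 2 : ℝ) * (l : ℝ)) * blockL2 (u τ) l).toReal) (Icc s t) := by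
  obtain ⟨B, hB0, hB⟩ := exists_lipRow_envelope hν hT hmax hLH hs hst htT
  have hc : ContinuousOn (fun τ => ∑' l : ℤ, ((2 : ℝ≥0∞) ^ ((5 / 2 : ℝ) * (l : ℝ)) * blockL2 (u τ) l).toReal) (Icc s t) := by
    refine continuousOn_tsum (fun l => continuousOn_weight52_blockL2 hν hT hmax hLH hs htT _ l)
      (summable_geom_natAbs B) fun l τ hτ => ?_
    rw [Real.norm_of_nonneg ENNReal.toReal_nonneg]
    exact (hB τ hτ).1 l
  exact hc.congr fun τ hτ => (hB τ hτ).2.2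

/-! ## Continuity of the fine-pair sums `Q_l` -/

/-- **The fine-pair sum `Q_l(τ) = ∑_{n≥0} ∑_{|m|≤2} a_{l−4+n}(τ) 2^{l−4+n+m} a_{l−4+n+m}(τ)` is finite and continuous in time**
on every `[s, t] ⊂ (0, T)`, for every level `l`: each term is continuous, and with `x_k = 2^{5k/2} a_k ≤ B 2^{−|k|/2} ≤ B`
the terms are dominated by `8B² 2^{−4(l−4+n)}` (`a_k 2^{k+m} a_{k+m} = 2^{−4k−3m/2} x_k x_{k+m}`), summable in `n`.
[folklore] -/
theorem continuousOn_paraQ2 {ν T : ℝ} (hν : 0 < ν) (hT : 0 < T)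
    {u : ℝ → EuclideanSpace ℝ (Fin 3) → EuclideanSpace ℝ (Fin 3)} {p : ℝ → EuclideanSpace ℝ (Fin 3) → ℝ}
    (hmax : IsMaximalSmoothSolution ν 0 u p T) (hLH : IsLerayHopfOn T ν 0 (u 0) u)
    {s t : ℝ} (hs : 0 < s) (hst : s ≤ t) (htT : t < T) (l : ℤ) :
    (∀ τ ∈ Icc s t, paraQ2 (blockL2 (u τ)) (fun k => (2 : ℝ≥0∞) ^ k * blockL2 (u τ) k) l ≠ ∞) ∧
    ContinuousOn (fun τ => (paraQ2 (blockL2 (u τ)) (fun k => (2 : ℝ≥0∞) ^ k * blockL2 (u τ) k) l).toReal)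
      (Icc s t) := by
  obtain ⟨B, hB0, hB⟩ := exists_lipRow_envelope hν hT hmax hLH hs hst htT
  have hsub : Icc s t ⊆ Ioo 0 T := fun τ hτ => ⟨hs.trans_le hτ.1, hτ.2.trans_lt htT⟩
  -- abbreviations
  set x : ℝ → ℤ → ℝ≥0∞ := fun τ k => (2 : ℝ≥0∞) ^ ((5 / 2 : ℝ) * (k : ℝ)) * blockL2 (u τ) k with hx
  set term : ℕ → ℝ → ℝ≥0∞ := fun n τ =>
    ∑ m ∈ Finset.Icc (-2 : ℤ) 2, blockL2 (u τ) (l - 4 + n) * ((2 : ℝ≥0∞) ^ (l - 4 + n + m) * blockL2 (u τ) (l - 4 + n + m))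
    with hterm
  have hQ : ∀ τ, paraQ2 (blockL2 (u τ)) (fun k => (2 : ℝ≥0∞) ^ k * blockL2 (u τ) k) l = ∑' n : ℕ, term n τ := fun τ => rfl
  -- the envelope of `x`: `x_k ≤ B` (from `≤ B 2^{-|k|/2}`)
  have hxtop : ∀ τ ∈ Icc s t, ∀ k, x τ k ≠ ∞ := fun τ hτ k =>
    ENNReal.mul_ne_top (RiccatiSlice.two_rpow_ne_top _)
      ((((isSmoothL2Field_slice_of_maximal hν hT hmax hLH (hsub hτ)).blockFn k).memLp_two).eLpNorm_ne_top)
  have hxB : ∀ τ ∈ Icc s t, ∀ k, (x τ k).toReal ≤ B := by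
    intro τ hτ k
    refine ((hB τ hτ).1 k).trans ?_
    have h1 : (2 : ℝ) ^ (-(1 / 2 : ℝ) * ((k.natAbs : ℕ) : ℝ)) ≤ 1 :=
      Real.rpow_le_one_of_one_le_of_nonpos (by norm_num) (by
        have : (0 : ℝ) ≤ (k.natAbs : ℕ) := Nat.cast_nonneg _
        nlinarith)
    nlinarith
  -- the identity `a_k 2^{k+m} a_{k+m} = 2^{-4k - 3m/2} x_k x_{k+m}`
  have hid : ∀ τ (k m : ℤ), blockL2 (u τ) k * ((2 : ℝ≥0∞) ^ (k + m) * blockL2 (u τ) (k + m)) =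
      (2 : ℝ≥0∞) ^ (-(4 : ℝ) * (k : ℝ) - (3 / 2 : ℝ) * (m : ℝ)) * (x τ k * x τ (k + m)) := by
    intro τ k m
    simp only [hx]
    rw [← ENNReal.rpow_intCast _ (k + m)]
    have epow : (2 : ℝ≥0∞) ^ (((k + m : ℤ) : ℝ)) =
        (2 : ℝ≥0∞) ^ (-(4 : ℝ) * (k : ℝ) - (3 / 2 : ℝ) * (m : ℝ)) *
          ((2 : ℝ≥0∞) ^ ((5 / 2 : ℝ) * (k : ℝ)) * (2 : ℝ≥0∞) ^ ((5 / 2 : ℝ) * ((k + m : ℤ) : ℝ))) := by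
      rw [← two_rpow_add, ← two_rpow_add]
      congr 1; push_cast; ring
    rw [epow]; ring
  -- each term is continuous
  have hterm_cont : ∀ n, ContinuousOn (fun τ => (term n τ).toReal) (Icc s t) := by
    intro n
    have hfin : ∀ τ ∈ Icc s t, ∀ m ∈ Finset.Icc (-2 : ℤ) 2,
        blockL2 (u τ) (l - 4 + n) * ((2 : ℝ≥0∞) ^ (l - 4 + n + m) * blockL2 (u τ) (l - 4 + n + m)) ≠ ∞ := by
      intro τ hτ m _
      rw [hid]
      exact ENNReal.mul_ne_top (RiccatiSlice.two_rpow_ne_top _) (ENNReal.mul_ne_top (hxtop τ hτ _) (hxtop τ hτ _))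
    have heq : ∀ τ ∈ Icc s t, (term n τ).toReal = ∑ m ∈ Finset.Icc (-2 : ℤ) 2,
        ((2 : ℝ) ^ (-(4 : ℝ) * (((l - 4 + n : ℤ)) : ℝ) - (3 / 2 : ℝ) * (m : ℝ))) *
          ((x τ (l - 4 + n)).toReal * (x τ (l - 4 + n + m)).toReal) := by
      intro τ hτ
      simp only [hterm]
      rw [ENNReal.toReal_sum (hfin τ hτ)]
      refine Finset.sum_congr rfl fun m _ => ?_
      rw [hid, ENNReal.toReal_mul, ENNReal.toReal_mul, ← ENNReal.toReal_rpow, ENNReal.toReal_ofNat]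
    refine ContinuousOn.congr ?_ heq
    refine continuousOn_finsetSum _ fun m _ => continuousOn_const.mul ?_
    have h1 := continuousOn_weight52_blockL2 hν hT hmax hLH hs htT ((2 : ℝ≥0∞) ^ ((5 / 2 : ℝ) * (((l - 4 + n : ℤ)) : ℝ))) (l - 4 + n)
    have h2 := continuousOn_weight52_blockL2 hν hT hmax hLH hs htT ((2 : ℝ≥0∞) ^ ((5 / 2 : ℝ) * (((l - 4 + n + m : ℤ)) : ℝ))) (l - 4 + n + m)
    exact h1.mul h2
  -- domination: `(term n τ).toReal ≤ 5 · 8 B² · 2^{-4(l-4+n)}`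
  set env : ℕ → ℝ := fun n => 5 * (8 * B ^ 2 * (2 : ℝ) ^ (-(4 : ℝ) * (((l - 4 + n : ℤ)) : ℝ))) with henv
  have hdom : ∀ n τ, τ ∈ Icc s t → ‖(term n τ).toReal‖ ≤ env n := by
    intro n τ hτ
    rw [Real.norm_of_nonneg ENNReal.toReal_nonneg]
    have hfin : ∀ m ∈ Finset.Icc (-2 : ℤ) 2,
        blockL2 (u τ) (l - 4 + n) * ((2 : ℝ≥0∞) ^ (l - 4 + n + m) * blockL2 (u τ) (l - 4 + n + m)) ≠ ∞ := by
      intro m _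
      rw [hid]
      exact ENNReal.mul_ne_top (RiccatiSlice.two_rpow_ne_top _) (ENNReal.mul_ne_top (hxtop τ hτ _) (hxtop τ hτ _))
    simp only [hterm]
    rw [ENNReal.toReal_sum hfin]
    have hm : ∀ m ∈ Finset.Icc (-2 : ℤ) 2,
        (blockL2 (u τ) (l - 4 + n) * ((2 : ℝ≥0∞) ^ (l - 4 + n + m) * blockL2 (u τ) (l - 4 + n + m))).toReal ≤
          8 * B ^ 2 * (2 : ℝ) ^ (-(4 : ℝ) * (((l - 4 + n : ℤ)) : ℝ)) := by
      intro m hm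
      rw [Finset.mem_Icc] at hm
      rw [hid, ENNReal.toReal_mul, ENNReal.toReal_mul, ← ENNReal.toReal_rpow, ENNReal.toReal_ofNat]
      have hm1 : (-2 : ℝ) ≤ m := by exact_mod_cast hm.1
      have hw : (2 : ℝ) ^ (-(4 : ℝ) * (((l - 4 + n : ℤ)) : ℝ) - (3 / 2 : ℝ) * (m : ℝ)) ≤
          8 * (2 : ℝ) ^ (-(4 : ℝ) * (((l - 4 + n : ℤ)) : ℝ)) := by
        rw [show (8 : ℝ) = (2 : ℝ) ^ (3 : ℝ) by norm_num, ← Real.rpow_add two_pos]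
        exact Real.rpow_le_rpow_of_exponent_le (by norm_num) (by nlinarith)
      have hx1 := hxB τ hτ (l - 4 + n)
      have hx2 := hxB τ hτ (l - 4 + n + m)
      have hx10 : 0 ≤ (x τ (l - 4 + n)).toReal := ENNReal.toReal_nonneg
      have hx20 : 0 ≤ (x τ (l - 4 + n + m)).toReal := ENNReal.toReal_nonneg
      calc (2 : ℝ) ^ (-(4 : ℝ) * (((l - 4 + n : ℤ)) : ℝ) - (3 / 2 : ℝ) * (m : ℝ)) *
            ((x τ (l - 4 + n)).toReal * (x τ (l - 4 + n + m)).toReal)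
          ≤ (8 * (2 : ℝ) ^ (-(4 : ℝ) * (((l - 4 + n : ℤ)) : ℝ))) * (B * B) := by
            refine mul_le_mul hw (mul_le_mul hx1 hx2 hx20 hB0) (by positivity) (by positivity)
        _ = 8 * B ^ 2 * (2 : ℝ) ^ (-(4 : ℝ) * (((l - 4 + n : ℤ)) : ℝ)) := by ring
    calc ∑ m ∈ Finset.Icc (-2 : ℤ) 2,
          (blockL2 (u τ) (l - 4 + n) * ((2 : ℝ≥0∞) ^ (l - 4 + n + m) * blockL2 (u τ) (l - 4 + n + m))).toReal
        ≤ ∑ _m ∈ Finset.Icc (-2 : ℤ) 2, 8 * B ^ 2 * (2 : ℝ) ^ (-(4 : ℝ) * (((l - 4 + n : ℤ)) : ℝ)) :=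
          Finset.sum_le_sum hm
      _ = env n := by rw [Finset.sum_const, Int.card_Icc]; simp [henv]
  have henv_sum : Summable env := by
    have hr : (2 : ℝ) ^ (-(4 : ℝ)) < 1 := Real.rpow_lt_one_of_one_lt_of_neg (by norm_num) (by norm_num)
    have hg := (summable_geometric_of_lt_one (by positivity) hr).mul_left
      (5 * (8 * B ^ 2 * (2 : ℝ) ^ (-(4 : ℝ) * (((l - 4 : ℤ)) : ℝ))))
    have hpow : ∀ n : ℕ, (2 : ℝ) ^ (-(4 : ℝ) * (((l - 4 + n : ℤ)) : ℝ)) =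
        (2 : ℝ) ^ (-(4 : ℝ) * (((l - 4 : ℤ)) : ℝ)) * ((2 : ℝ) ^ (-(4 : ℝ))) ^ n := by
      intro n
      rw [← Real.rpow_natCast ((2 : ℝ) ^ (-(4 : ℝ))) n, ← Real.rpow_mul (by norm_num : (0 : ℝ) ≤ 2),
        ← Real.rpow_add two_pos]
      congr 1; push_cast; ring
    refine hg.congr fun n => ?_
    simp only [henv]
    rw [hpow n]
    ring
  -- finiteness: the ENNReal series is bounded by the real envelope
  have hfinQ : ∀ τ ∈ Icc s t, paraQ2 (blockL2 (u τ)) (fun k => (2 : ℝ≥0∞) ^ k * blockL2 (u τ) k) l ≠ ∞ := by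
    intro τ hτ
    rw [hQ]
    have hfinterm : ∀ n, term n τ ≠ ∞ := fun n => by
      simp only [hterm]
      refine ENNReal.sum_ne_top.2 fun m _ => ?_
      rw [hid]
      exact ENNReal.mul_ne_top (RiccatiSlice.two_rpow_ne_top _) (ENNReal.mul_ne_top (hxtop τ hτ _) (hxtop τ hτ _))
    have hle : ∑' n, term n τ ≤ ∑' n, ENNReal.ofReal (env n) := by
      refine ENNReal.tsum_le_tsum fun n => ?_
      rw [← ENNReal.ofReal_toReal (hfinterm n)]
      exact ENNReal.ofReal_le_ofReal ((le_abs_self _).trans (by simpa [Real.norm_eq_abs] using hdom n τ hτ))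
    exact ne_top_of_le_ne_top henv_sum.tsum_ofReal_ne_top hle
  refine ⟨hfinQ, ?_⟩
  have hc : ContinuousOn (fun τ => ∑' n, (term n τ).toReal) (Icc s t) := continuousOn_tsum hterm_cont henv_sum hdom
  refine hc.congr fun τ hτ => ?_
  rw [hQ, ENNReal.tsum_toReal_eq]
  intro n
  simp only [hterm]
  refine ENNReal.sum_ne_top.2 fun m _ => ?_
  rw [hid]
  exact ENNReal.mul_ne_top (RiccatiSlice.two_rpow_ne_top _) (ENNReal.mul_ne_top (hxtop τ hτ _) (hxtop τ hτ _))

end Summit.NavierStokesRegularity.FluidComputer.LipRowContinuity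

end
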